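import Summits.BirchSwinnertonDyer.Rank1Residual.Additive.X4SharpThreeAssembly
import Summits.BirchSwinnertonDyer.Rank1Residual.Additive.X4RankZeroKatoBoundSharp
import HarnessLib

/-!
# X4♯(3) REDUCED TO ITS RESIDUE — with the V20 reading (`3 ∤ ∏ c_ℓ`) and with the SHARPENED
# reading (no Tamagawa binder): granted the named facts, the conjecture is EQUIVALENT to its
# restriction to the potentially good rows WITHOUT `3`-adic tower surjectivity
# (cell `b2b-bsdres`, seat additive-p4, line V21; sibling of `Additive/X4SharpThreeAssembly.lean`)

HONEST FRAMING (cell `b2b-bsdres`, run/shared/lean/b2b/bsd-rank1-residual/, verbatim in every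
file): the goal of the cell is to DELETE the COMBINATION-SHAPED residual classes of the
Birch–Swinnerton-Dyer formula for ALL analytic-rank `≤ 1` elliptic curves over `ℚ` — "full BSD
formula for every rank `≤ 1` curve in class `C`" assembled STRICTLY from published theorems — so
that the rank-`≤ 1` remainder becomes exactly the CONSTRUCTION-SHAPED classes, which are TYPED
(missing-input `Prop`s), NOT attempted. This is not "finishing BSD". Sub-cell additive-p4 (X3♯/X4♯
direct): research route on the CONSTRUCTION-SHAPED class X4; no claim beyond the stated classes;
the label X4 is UNCHANGED by this file; nothing is booked. Theorems only (no definition, no named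
fact).

§A (V20 reading `Kato2004.rankZero_padicValNat_sha_le_of_additive_potGood_of_imageContainsSL2`,
binder `3 ∤ ∏ c_ℓ`):
* **`x4SharpThree_iff_residue`** — granted the five named facts of the two published routes (Kato
  2004 Thm. 14.5 (3) + Prop. 14.16 (2) at an additive potentially good odd `p`; Delbourgo 1998
  Prop. 4; Wuthrich 2014 Lemma 20; Kato's divisibility on the `ω`-component over `ℚ(ζ_{3^∞})`;
  modular parametrisation data), GZK and modularity, `Additive.X4SharpThree` is EQUIVALENT to its
  restriction to the X4 pairs `(E, 3)` of analytic rank `0` with `ρ̄_{E,3}` onto, `ord₃ j(E) ≥ 0`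
  and NOT [(`ρ̄_{E,3^n}` onto ∀ `n`) ∧ `3 ∤ ∏ c_ℓ`]; `x4SharpThree_of_censusResidue` — it follows
  from its restriction to {`ord₃ j ≥ 0` ∧ ((no `j`-witness ∧ ¬surj(9)) ∨ `3 ∣ ∏ c_ℓ`)}.

§B (SHARPENED reading `Kato2004.rankZero_padicValNat_sha_le_sub_localTamagawa_…`, lit-kato
p243325: Kim 2026 §3.2.3's general display, NO Tamagawa hypothesis, conclusion
`ord_p #Ш ≤ ord_p(L/Ω) − v_p(c_p)`; consumer `X4RankZero.padicValNat_shaOrder_le_of_katoSharp`,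
`Additive/X4RankZeroKatoBoundSharp.lean`): on X4 ∧ `r_an = 0` ∧ `ord₃ j ≥ 0` ∧ tower surjectivity
the conjecture's inequality holds with NO Tamagawa hypothesis, hence
* lit-kato's `x4SharpThree_holds_of_potGood_of_towerSurj_sharp` (p244168) and, here, `x4SharpThree_conclusion_of_cert_sharp`;
* **`x4SharpThree_iff_residue_sharp`** — X4♯(3) ⟺ its restriction to {`ord₃ j ≥ 0` ∧
  ¬(`ρ̄_{E,3^n}` onto ∀ `n`)}; `x4SharpThree_of_censusResidue_sharp` — ⟸ its restriction to
  {`ord₃ j ≥ 0` ∧ no `j`-witness ∧ ¬surj(9)};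
* `X4RankZero.missingUpperBoundAt_three_of_cert_sharp`, `X4RankZero.bsdp_three_of_cert_of_shaAn_unit_sharp`
  — the typed upper half / `BSD(E,3)` on the certified rows with the per-pair binder
  `ord₃ ∏ c_ℓ = ord₃ c₃` (`3 ∣ c₃` allowed: Kodaira IV/IV* with `c₃ = 3`).

Seat census V21/V21b (engine A + a-invariants; two mod-9 engines — sha-2's img3adic and the
seat's Frobenius certificate kit j112466/j112787 agree on all 1 965 surjective window rows): the
residue of §B holds 20 curves of the S-b sweep (N < 5·10⁵; among them the one window curve,
7776f1) with `j ∈ {15786448344, 4374, −44789760}` — three INTEGRAL j-invariants (cf.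
`GaloisImage.dvd_padicValRat_j_of_surj_three_of_not_surj_nine`: an exotic 3-adic image has
`3 ∣ ord_q j` at every pole), Elkies' mod-3-not-mod-9 images (arXiv:math/0612734). Nothing
asserted about the residue; X4 stays CONSTRUCTION-SHAPED; nothing booked.

References: Kato 2004 [Kato2004Asterisque] Thm. 14.5 (3), Prop. 14.16 (2), Thm. 17.4 (3); C.-H.
Kim 2026 [Kim2022StructureSelmer] §3.2.3; Delbourgo 1998 [Delbourgo1998] Prop. 4; Wuthrich 2014
[Wuthrich2014] Lemma 20; Miller 2011 [Miller2011LMS] Def. 1.1; Silverman *ATAEC* V.5.3; Serre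
1968 IV §3.4; N. Elkies, arXiv:math/0612734.
-/

noncomputable section

open scoped Classical

open WeierstrassCurve Literature.NumberTheory.EllipticCurves
  Literature.NumberTheory.EllipticCurves.ModularForms
  Literature.NumberTheory.EllipticCurves.Rank1Residual
  Literature.NumberTheory.EllipticCurves.Rank1Residual.Typed

namespace Summit.BirchSwinnertonDyer.Rank1Residual.Additive

variable (W : WeierstrassCurve ℚ) [W.IsElliptic] [W.IsGloballyMinimal]

/-! ### §A The REDUCTION of X4♯(3) to its residue (V20 reading, `3 ∤ ∏ c_ℓ`) -/

/-- **X4♯(3) ⟺ X4♯(3) on its RESIDUE** (granted the named facts of the two routes, GZK and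
modularity): the conjecture `Additive.X4SharpThree` is EQUIVALENT to its restriction to the X4 pairs
`(E, 3)` of analytic rank `0` with `ρ̄_{E,3}` onto, `ord₃ j(E) ≥ 0`, and NOT [(`ρ̄_{E,3^n}` onto ∀ `n`)
∧ `3 ∤ ∏ c_ℓ`] — i.e. potentially good at `3` and either lacking `3`-adic surjectivity or with
`3 ∣ ∏ c_ℓ`. Everything else of X4♯(3) is a theorem modulo the named facts. Nothing asserted about
the residue; X4 stays CONSTRUCTION-SHAPED; nothing booked.
[cite: Kato2004Asterisque, Thm. 14.5 (3) (p. 236), Thm. 17.4 (3) (p. 273)] [cite: Delbourgo1998, Prop. 4 (p. 144)] -/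
theorem x4SharpThree_iff_residue
    (hKato : Kato2004.rankZero_padicValNat_sha_le_of_additive_potGood_of_imageContainsSL2)
    (hDel : Delbourgo1998.prop4_rankZero_pow_dvd_constantCoeff)
    (hGZK : rank_eq_analyticRank_of_analyticRank_le_one) (hmod : hasEntireLFunction_rat)
    (hmodD : nonempty_modularParametrizationData)
    (hL20 : Wuthrich2014.lemma20_surjective_threeAdic_of_semistable)
    (hKatoω : Wuthrich2014.kato_minusEigenCharIdeal_dvd_cyclotomicThree_of_surjective) :
    X4SharpThree ↔
      ∀ (W : WeierstrassCurve ℚ) [W.IsElliptic] [W.IsGloballyMinimal],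
        W.analyticRank = 0 → ClassX4 W 3 → Surj W 3 → 0 ≤ padicValRat 3 W.j →
        ¬ ((∀ n : ℕ, W.HasSurjectiveModNGaloisRep (3 ^ n : ℕ)) ∧ ¬ 3 ∣ W.tamagawaProduct) →
        ∀ {N : ℕ} [NeZero N] (D : ModularParametrizationData W N), ¬ (3 : ℤ) ∣ D.maninConstant →
        ∃ q : ℚ, shaAn W = (q : ℂ) ∧
          (padicValNat 3 W.shaOrder : ℤ) ≤ padicValRat 3 q + padicValNat 3 W.tamagawaProduct := by
  constructor
  · intro h V _ _ hr hX hsurj _ _ N _ D hc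
    exact h V hr hX hsurj D hc
  · intro hres V _ _ hr hX hsurj N _ D hc
    by_cases hj : padicValRat 3 V.j < 0
    · exact x4SharpThree_conclusion_of_potMult V hDel hGZK hmod hmodD hL20 hKatoω hr hX hsurj hj
    · by_cases hgood :
          (∀ n : ℕ, V.HasSurjectiveModNGaloisRep (3 ^ n : ℕ)) ∧ ¬ 3 ∣ V.tamagawaProduct
      · exact x4SharpThree_holds_of_potGood_of_towerSurj V hKato hGZK hmod hr hX (not_lt.mp hj) hgood.1
          hgood.2 D hc
      · exact hres V hr hX hsurj (not_lt.mp hj) hgood D hc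

/-- **X4♯(3) FOLLOWS from its restriction to the CENSUS-DECIDABLE residue** `ord₃ j ≥ 0` ∧
[(no `j`-witness ∧ ¬surj(9)) ∨ `3 ∣ ∏ c_ℓ`] (granted the named facts): every a-invariant-decidable
certificate of the census (potential multiplicativity at `3`, a `j`-witness, a mod-`9` image
certificate, the Tamagawa bit) has been spent. Seat census V21: the residue holds 36 of the 1 582
window unit rows (1 494 of 144 122 in the S-b sweep) plus the potentially good `3 ∣ ∏ c_ℓ` rows.
[cite: Kato2004Asterisque, Thm. 14.5 (3) (p. 236), Thm. 17.4 (3) (p. 273)] [cite: Delbourgo1998, Prop. 4 (p. 144)]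
[cite: SilvermanATAEC1994, V.5.3] -/
theorem x4SharpThree_of_censusResidue
    (hKato : Kato2004.rankZero_padicValNat_sha_le_of_additive_potGood_of_imageContainsSL2)
    (hDel : Delbourgo1998.prop4_rankZero_pow_dvd_constantCoeff)
    (hGZK : rank_eq_analyticRank_of_analyticRank_le_one) (hmod : hasEntireLFunction_rat)
    (hmodD : nonempty_modularParametrizationData)
    (hL20 : Wuthrich2014.lemma20_surjective_threeAdic_of_semistable)
    (hKatoω : Wuthrich2014.kato_minusEigenCharIdeal_dvd_cyclotomicThree_of_surjective)
    (hres : ∀ (W : WeierstrassCurve ℚ) [W.IsElliptic] [W.IsGloballyMinimal],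
        W.analyticRank = 0 → ClassX4 W 3 → Surj W 3 → 0 ≤ padicValRat 3 W.j →
        ((∀ q : ℕ, q.Prime → q ≠ 3 → padicValRat q W.j < 0 → (3 : ℤ) ∣ padicValRat q W.j) ∧
            ¬ W.HasSurjectiveModNGaloisRep 9 ∨ 3 ∣ W.tamagawaProduct) →
        ∀ {N : ℕ} [NeZero N] (D : ModularParametrizationData W N), ¬ (3 : ℤ) ∣ D.maninConstant →
        ∃ q : ℚ, shaAn W = (q : ℂ) ∧
          (padicValNat 3 W.shaOrder : ℤ) ≤ padicValRat 3 q + padicValNat 3 W.tamagawaProduct) :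
    X4SharpThree := by
  intro V _ _ hr hX hsurj N _ D hc
  by_cases hj : padicValRat 3 V.j < 0
  · exact x4SharpThree_conclusion_of_potMult V hDel hGZK hmod hmodD hL20 hKatoω hr hX hsurj hj
  · by_cases htam : 3 ∣ V.tamagawaProduct
    · exact hres V hr hX hsurj (not_lt.mp hj) (Or.inr htam) D hc
    · by_cases hc' : (∃ q : ℕ, q.Prime ∧ q ≠ 3 ∧ padicValRat q V.j < 0 ∧
          ¬ (3 : ℤ) ∣ padicValRat q V.j) ∨ V.HasSurjectiveModNGaloisRep 9
      · exact x4SharpThree_holds_of_potGood_of_towerSurj V hKato hGZK hmod hr hX (not_lt.mp hj)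
          (towerSurj_three_of_surj_of_jWitness_or_nine V hsurj hc') htam D hc
      · refine hres V hr hX hsurj (not_lt.mp hj) (Or.inl ⟨fun q hq hq3 hneg ↦ ?_, fun h9 ↦ ?_⟩) D hc
        · by_contra hnd
          exact hc' (Or.inl ⟨q, hq, hq3, hneg, hnd⟩)
        · exact hc' (Or.inr h9)

/-! ### §B.1 X4♯(3)'s conclusion with the sharpened reading -/

/-- **X4♯(3)'s conclusion from the census certificates, SHARP** — `ord₃ j < 0` (additive-p1's (M)
route, no Tamagawa hypothesis) OR a tower certificate (`j`-witness / surj(9); Kato sharp, no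
Tamagawa hypothesis). [cite: Kato2004Asterisque, Thm. 14.5 (3) (p. 236), Thm. 17.4 (3) (p. 273)]
[cite: Delbourgo1998, Prop. 4 (p. 144)] [cite: Kim2022StructureSelmer, §3.2.3 display before Thm. 3.7 (PDF p. 16)] -/
theorem x4SharpThree_conclusion_of_cert_sharp
    (hKatoS : Kato2004.rankZero_padicValNat_sha_le_sub_localTamagawa_of_additive_potGood_of_imageContainsSL2)
    (hDel : Delbourgo1998.prop4_rankZero_pow_dvd_constantCoeff)
    (hGZK : rank_eq_analyticRank_of_analyticRank_le_one) (hmod : hasEntireLFunction_rat)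
    (hmodD : nonempty_modularParametrizationData)
    (hL20 : Wuthrich2014.lemma20_surjective_threeAdic_of_semistable)
    (hKatoω : Wuthrich2014.kato_minusEigenCharIdeal_dvd_cyclotomicThree_of_surjective)
    (hr : W.analyticRank = 0) (hX : ClassX4 W 3) (hsurj : Surj W 3)
    (hcert : padicValRat 3 W.j < 0 ∨
      (∃ q : ℕ, q.Prime ∧ q ≠ 3 ∧ padicValRat q W.j < 0 ∧ ¬ (3 : ℤ) ∣ padicValRat q W.j) ∨
        W.HasSurjectiveModNGaloisRep 9)
    {N : ℕ} [NeZero N] (D : ModularParametrizationData W N) (hc : ¬ (3 : ℤ) ∣ D.maninConstant) :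
    ∃ q : ℚ, shaAn W = (q : ℂ) ∧
      (padicValNat 3 W.shaOrder : ℤ) ≤ padicValRat 3 q + padicValNat 3 W.tamagawaProduct := by
  by_cases hj : padicValRat 3 W.j < 0
  · exact x4SharpThree_conclusion_of_potMult W hDel hGZK hmod hmodD hL20 hKatoω hr hX hsurj hj
  · have hc' : (∃ q : ℕ, q.Prime ∧ q ≠ 3 ∧ padicValRat q W.j < 0 ∧ ¬ (3 : ℤ) ∣ padicValRat q W.j) ∨
        W.HasSurjectiveModNGaloisRep 9 := by
      rcases hcert with h | h | h
      · exact absurd h hj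
      · exact Or.inl h
      · exact Or.inr h
    exact x4SharpThree_holds_of_potGood_of_towerSurj_sharp W hKatoS hGZK hmod hr hX (not_lt.mp hj)
      (towerSurj_three_of_surj_of_jWitness_or_nine W hsurj hc') D hc

/-! ### §B.2 `BSD(E,3)` and the typed upper half on the certified rows, `3 ∣ c₃` allowed -/

/-- **The typed UPPER HALF on every certified row, SHARP**: `ord₃ j < 0` (no Tamagawa hypothesis)
OR [a tower certificate and `ord₃ ∏ c_ℓ = ord₃ c₃`, i.e. `3 ∤ c_ℓ` for `ℓ ≠ 3`].
[cite: Kato2004Asterisque, Thm. 14.5 (3) (p. 236), Thm. 17.4 (3) (p. 273)] [cite: Delbourgo1998, Prop. 4 (p. 144)]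
[cite: Miller2011LMS, Def. 1.1] -/
theorem X4RankZero.missingUpperBoundAt_three_of_cert_sharp
    (hKatoS : Kato2004.rankZero_padicValNat_sha_le_sub_localTamagawa_of_additive_potGood_of_imageContainsSL2)
    (hDel : Delbourgo1998.prop4_rankZero_pow_dvd_constantCoeff)
    (hGZK : rank_eq_analyticRank_of_analyticRank_le_one) (hmod : hasEntireLFunction_rat)
    (hmodD : nonempty_modularParametrizationData)
    (hL20 : Wuthrich2014.lemma20_surjective_threeAdic_of_semistable)
    (hKatoω : Wuthrich2014.kato_minusEigenCharIdeal_dvd_cyclotomicThree_of_surjective)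
    (hr : W.analyticRank = 0) (hX : ClassX4 W 3) (hsurj : Surj W 3)
    (hcert : padicValRat 3 W.j < 0 ∨
      ((∃ q : ℕ, q.Prime ∧ q ≠ 3 ∧ padicValRat q W.j < 0 ∧ ¬ (3 : ℤ) ∣ padicValRat q W.j) ∨
        W.HasSurjectiveModNGaloisRep 9) ∧
      padicValNat 3 W.tamagawaProduct =
        padicValNat 3 ((WeierstrassCurve.baseChange W ℚ_[3]).localTamagawaNumber ℤ_[3]))
    {N : ℕ} [NeZero N] (D : ModularParametrizationData W N) (hc : ¬ (3 : ℤ) ∣ D.maninConstant) :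
    MissingUpperBoundAt W 3 := by
  haveI : Fact (Nat.Prime 3) := ⟨Nat.prime_three⟩
  by_cases hj : padicValRat 3 W.j < 0
  · exact AdditivePotMult.ClassX4M.missingUpperBoundAt_three_rankZero_of_surj hDel hGZK hmod hmodD
      hL20 hKatoω ⟨hX, hX.2.1, hj⟩ hr hsurj
  · rcases hcert with h | ⟨hc', htam⟩
    · exact absurd h hj
    · exact X4RankZero.missingUpperBoundAt_of_katoSharp W 3 hKatoS hGZK hmod hr hX (not_lt.mp hj)
        (towerSurj_three_of_surj_of_jWitness_or_nine W hsurj hc') htam D (by exact_mod_cast hc)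

/-- **`BSD(E,3)` on every certified unit-`#Ш_an` row, SHARP**: X4 ∧ `r_an = 0` ∧ surj(3) ∧ `#Ш_an`
a `3`-unit ∧ [`ord₃ j < 0` ∨ (tower certificate ∧ `ord₃ ∏ c_ℓ = ord₃ c₃`)], datum `D` with `3 ∤ c_D`
(used on the potentially good branch only) — the `3 ∣ c₃`-only rows (Kodaira IV/IV*, `c₃ = 3`,
`3 ∤ c_ℓ` for `ℓ ≠ 3`) included. [cite: Kato2004Asterisque, Thm. 14.5 (3) (p. 236), Thm. 17.4 (3) (p. 273)]
[cite: Delbourgo1998, Prop. 4 (p. 144)] [cite: Miller2011LMS, §1 and Def. 1.1] -/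
theorem X4RankZero.bsdp_three_of_cert_of_shaAn_unit_sharp
    (hKatoS : Kato2004.rankZero_padicValNat_sha_le_sub_localTamagawa_of_additive_potGood_of_imageContainsSL2)
    (hDel : Delbourgo1998.prop4_rankZero_pow_dvd_constantCoeff)
    (hGZK : rank_eq_analyticRank_of_analyticRank_le_one) (hmod : hasEntireLFunction_rat)
    (hmodD : nonempty_modularParametrizationData)
    (hL20 : Wuthrich2014.lemma20_surjective_threeAdic_of_semistable)
    (hKatoω : Wuthrich2014.kato_minusEigenCharIdeal_dvd_cyclotomicThree_of_surjective)
    (hr : W.analyticRank = 0) (hX : ClassX4 W 3) (hsurj : Surj W 3)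
    (hcert : padicValRat 3 W.j < 0 ∨
      ((∃ q : ℕ, q.Prime ∧ q ≠ 3 ∧ padicValRat q W.j < 0 ∧ ¬ (3 : ℤ) ∣ padicValRat q W.j) ∨
        W.HasSurjectiveModNGaloisRep 9) ∧
      padicValNat 3 W.tamagawaProduct =
        padicValNat 3 ((WeierstrassCurve.baseChange W ℚ_[3]).localTamagawaNumber ℤ_[3]))
    {N : ℕ} [NeZero N] (D : ModularParametrizationData W N) (hc : ¬ (3 : ℤ) ∣ D.maninConstant)
    {q : ℚ} (hq : shaAn W = (q : ℂ)) (hv : padicValRat 3 q = 0) : BSDp W 3 := by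
  haveI : Fact (Nat.Prime 3) := ⟨Nat.prime_three⟩
  by_cases hj : padicValRat 3 W.j < 0
  · exact AdditivePotMult.ClassX4M.bsdp_three_rankZero_of_surj_of_shaAn_unit hDel hGZK hmod hmodD
      hL20 hKatoω ⟨hX, hX.2.1, hj⟩ hr hsurj hq hv
  · rcases hcert with h | ⟨hc', htam⟩
    · exact absurd h hj
    · exact X4RankZero.bsdp_of_shaAn_unit_of_katoSharp W 3 hKatoS hGZK hmod hr hX (not_lt.mp hj)
        (towerSurj_three_of_surj_of_jWitness_or_nine W hsurj hc') htam D (by exact_mod_cast hc) hq hv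

/-! ### §B.3 The residue with the sharpened reading: potentially good and NOT `3`-adically surjective -/

/-- **X4♯(3) ⟺ X4♯(3) on {`ord₃ j ≥ 0` ∧ ¬(`ρ̄_{E,3^n}` onto ∀ `n`)}** (granted the sharpened Kato
reading, Delbourgo Prop. 4, Wuthrich Lemma 20, the `ω`-component divisibility, modular
parametrisation data, GZK and modularity): the Tamagawa bit has left the residue. Nothing asserted
about the residue; X4 stays CONSTRUCTION-SHAPED; nothing booked.
[cite: Kato2004Asterisque, Thm. 14.5 (3) (p. 236), Thm. 17.4 (3) (p. 273)] [cite: Delbourgo1998, Prop. 4 (p. 144)]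
[cite: Kim2022StructureSelmer, §3.2.3 display before Thm. 3.7 (PDF p. 16)] -/
theorem x4SharpThree_iff_residue_sharp
    (hKatoS : Kato2004.rankZero_padicValNat_sha_le_sub_localTamagawa_of_additive_potGood_of_imageContainsSL2)
    (hDel : Delbourgo1998.prop4_rankZero_pow_dvd_constantCoeff)
    (hGZK : rank_eq_analyticRank_of_analyticRank_le_one) (hmod : hasEntireLFunction_rat)
    (hmodD : nonempty_modularParametrizationData)
    (hL20 : Wuthrich2014.lemma20_surjective_threeAdic_of_semistable)
    (hKatoω : Wuthrich2014.kato_minusEigenCharIdeal_dvd_cyclotomicThree_of_surjective) :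
    X4SharpThree ↔
      ∀ (W : WeierstrassCurve ℚ) [W.IsElliptic] [W.IsGloballyMinimal],
        W.analyticRank = 0 → ClassX4 W 3 → Surj W 3 → 0 ≤ padicValRat 3 W.j →
        ¬ (∀ n : ℕ, W.HasSurjectiveModNGaloisRep (3 ^ n : ℕ)) →
        ∀ {N : ℕ} [NeZero N] (D : ModularParametrizationData W N), ¬ (3 : ℤ) ∣ D.maninConstant →
        ∃ q : ℚ, shaAn W = (q : ℂ) ∧
          (padicValNat 3 W.shaOrder : ℤ) ≤ padicValRat 3 q + padicValNat 3 W.tamagawaProduct := by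
  constructor
  · intro h V _ _ hr hX hsurj _ _ N _ D hc
    exact h V hr hX hsurj D hc
  · intro hres V _ _ hr hX hsurj N _ D hc
    by_cases hj : padicValRat 3 V.j < 0
    · exact x4SharpThree_conclusion_of_potMult V hDel hGZK hmod hmodD hL20 hKatoω hr hX hsurj hj
    · by_cases htower : ∀ n : ℕ, V.HasSurjectiveModNGaloisRep (3 ^ n : ℕ)
      · exact x4SharpThree_holds_of_potGood_of_towerSurj_sharp V hKatoS hGZK hmod hr hX (not_lt.mp hj)
          htower D hc
      · exact hres V hr hX hsurj (not_lt.mp hj) htower D hc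

/-- **X4♯(3) FOLLOWS from its restriction to {`ord₃ j ≥ 0` ∧ no `j`-witness ∧ ¬surj(9)}** (granted
the same facts) — the census-decidable residue; by the seat's census V21/V21b it holds one window
curve (7776f1) among the 20 S-b sweep curves with `j ∈ {15786448344, 4374, −44789760}` (N < 5·10⁵).
[cite: Kato2004Asterisque, Thm. 14.5 (3) (p. 236), Thm. 17.4 (3) (p. 273)] [cite: Delbourgo1998, Prop. 4 (p. 144)]
[cite: Kim2022StructureSelmer, §3.2.3 display before Thm. 3.7 (PDF p. 16)] -/
theorem x4SharpThree_of_censusResidue_sharp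
    (hKatoS : Kato2004.rankZero_padicValNat_sha_le_sub_localTamagawa_of_additive_potGood_of_imageContainsSL2)
    (hDel : Delbourgo1998.prop4_rankZero_pow_dvd_constantCoeff)
    (hGZK : rank_eq_analyticRank_of_analyticRank_le_one) (hmod : hasEntireLFunction_rat)
    (hmodD : nonempty_modularParametrizationData)
    (hL20 : Wuthrich2014.lemma20_surjective_threeAdic_of_semistable)
    (hKatoω : Wuthrich2014.kato_minusEigenCharIdeal_dvd_cyclotomicThree_of_surjective)
    (hres : ∀ (W : WeierstrassCurve ℚ) [W.IsElliptic] [W.IsGloballyMinimal],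
        W.analyticRank = 0 → ClassX4 W 3 → Surj W 3 → 0 ≤ padicValRat 3 W.j →
        (∀ q : ℕ, q.Prime → q ≠ 3 → padicValRat q W.j < 0 → (3 : ℤ) ∣ padicValRat q W.j) →
        ¬ W.HasSurjectiveModNGaloisRep 9 →
        ∀ {N : ℕ} [NeZero N] (D : ModularParametrizationData W N), ¬ (3 : ℤ) ∣ D.maninConstant →
        ∃ q : ℚ, shaAn W = (q : ℂ) ∧
          (padicValNat 3 W.shaOrder : ℤ) ≤ padicValRat 3 q + padicValNat 3 W.tamagawaProduct) :
    X4SharpThree := by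
  intro V _ _ hr hX hsurj N _ D hc
  by_cases hc' : padicValRat 3 V.j < 0 ∨
      (∃ q : ℕ, q.Prime ∧ q ≠ 3 ∧ padicValRat q V.j < 0 ∧ ¬ (3 : ℤ) ∣ padicValRat q V.j) ∨
        V.HasSurjectiveModNGaloisRep 9
  · exact x4SharpThree_conclusion_of_cert_sharp V hKatoS hDel hGZK hmod hmodD hL20 hKatoω hr hX hsurj
      hc' D hc
  · have hj : 0 ≤ padicValRat 3 V.j := not_lt.mp fun h ↦ hc' (Or.inl h)
    have hno9 : ¬ V.HasSurjectiveModNGaloisRep 9 := fun h ↦ hc' (Or.inr (Or.inr h))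
    refine hres V hr hX hsurj hj (fun q hq hq3 hneg ↦ ?_) hno9 D hc
    by_contra hnd
    exact hc' (Or.inr (Or.inl ⟨q, hq, hq3, hneg, hnd⟩))

end Summit.BirchSwinnertonDyer.Rank1Residual.Additive

end
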